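import Summits.AtomisticToContinuum.Crystallization.Theorems.ExcessDecayLiouvillePhononStabilityCertCover

/-!
# Near-certificate layer B0: Bloch-symbol vocabulary and the spectral-corner principle (lead c3, skeleton v10)

Support file for crux `PhononStability` (stmt-AtomisticToContinuum-9333), line `contragredient-window-collapse`.

Skeleton v10 reshapes the open stub `stub_nearF : NearCertificateF` in two places:

* **per-node discharge by the Bloch symbol** (human certificate objective, 2026-08-17: Hermitian eigen-enclosure
  certificates): every node obligation of the vertex scheme is the nonnegativity of a translation-invariant
  finite-range pair form `Σ_{(c,M) ∈ L} pairEval c M w` with RATIONAL pair tables `L` on all finitely supported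
  label fields (`PairFormNonneg L`).  Its 6 × 6 Hermitian Bloch symbol is the quadratic form `symbolForm L z a`
  in the sublattice amplitudes `a : Fin 2 → ℂ³` at the phases `z ∈ 𝕋³ = {|zᵢ| = 1}` (the phase of class
  `(m, m', n)` is `zⁿ = ∏ zᵢ ^ nᵢ`).  `BlochReduction` (stub, analytic: finite-torus Plancherel) says that
  `SymbolPSD L` (the symbol form is `≥ 0` on the torus) implies `PairFormNonneg L`; the symbol is then certified
  natively by a θ-box scan with exact evaluation at rational circle points (later layers B1–B4).
* **exact collapse of the metric window to its spectral corners**: the pulled-back metric `Ĝ = (⟪A genᵢ, A genⱼ⟫)`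
  of a window datum lies in the convex body `Kmetric = {G symmetric : a² M₀ ⪯ G ⪯ b² M₀}` (`a = 189/200`,
  `b = 199/200`, `M₀` the Gram matrix of the generators).  A function CONCAVE on `Kmetric` that is nonnegative at the
  corners `a² M₀`, `b² M₀`, `(m + ε) M₀ − 2ε p pᵀ`, `(m − ε) M₀ + 2ε p pᵀ` (`pᵀ M₀⁻¹ p = 1`; `m = (a²+b²)/2`,
  `ε = (b²−a²)/2`) is nonnegative on `Kmetric` (`SpectralCornerPrinciple`, stub, analytic: simultaneous
  diagonalisation of `(G, M₀)` and concavity on the cube of eigenvalues).  The tangent/`H⁺` model of the near form is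
  concave in `Ĝ`, so the 6 metric dimensions of the window reduce to two 2-parameter families and two points —
  no chart box ever leaves the spectral band.

Everything here is vocabulary plus two elementary facts (`ghat_mem_Kwin`, `symbolForm_nil`). [folklore]
-/

noncomputable section

open scoped BigOperators Classical InnerProductSpace ComplexConjugate
open Filter Set Function
open Summit.AtomisticToContinuum.Crystallization.Theorems.PhononStabilityNegative

namespace Summit.AtomisticToContinuum.Crystallization.Theorems.PhononStabilityCWC.Cert

local notation "E3" => EuclideanSpace ℝ (Fin 3)

/-! ## Bloch symbol of a pair-table list -/

/-- The phase monomial `zⁿ = ∏ᵢ zᵢ ^ nᵢ` (integer powers) of a lattice translation `n`. [folklore] -/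
def phase (z : Fin 3 → ℂ) (n : Fin 3 → ℤ) : ℂ := ∏ i, z i ^ n i

/-- Sesquilinear extension of `bil`: `Σᵢⱼ Mᵢⱼ · conj xᵢ · yⱼ`. [folklore] -/
def cbil (M : Mat) (x y : Fin 3 → ℂ) : ℂ := ∑ i, ∑ j, (M i j : ℂ) * conj (x i) * y j

/-- Bloch amplitude difference of the class `c = (m, m', n)`: `zⁿ · a m' − a m`. [folklore] -/
def blochDiff (c : BondClass) (z : Fin 3 → ℂ) (a : Fin 2 → Fin 3 → ℂ) : Fin 3 → ℂ :=
  fun i => phase z c.2.2 * a c.2.1 i - a c.1 i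

/-- The symbol quadratic form of a pair-table list at phases `z` and sublattice amplitudes `a`:
`Σ_{(c,M) ∈ L} Re ⟪Δ_c(z) a, M Δ_c(z) a⟫`. [folklore] -/
def symbolForm (L : List (BondClass × Mat)) (z : Fin 3 → ℂ) (a : Fin 2 → Fin 3 → ℂ) : ℝ :=
  (L.map fun e => (cbil e.2 (blochDiff e.1 z a) (blochDiff e.1 z a)).re).sum

/-- The phase torus `𝕋³ = {z : |zᵢ| = 1}`. [folklore] -/
def unitTorus : Set (Fin 3 → ℂ) := {z | ∀ i, ‖z i‖ = 1}

/-- The Bloch symbol of `L` is positive semidefinite at every point of the torus. [folklore] -/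
def SymbolPSD (L : List (BondClass × Mat)) : Prop :=
  ∀ z ∈ unitTorus, ∀ a : Fin 2 → Fin 3 → ℂ, 0 ≤ symbolForm L z a

/-- The real-space pair form of a pair-table list: `Σ_{(c,M) ∈ L} pairEval c M w`. [folklore] -/
def pairSum (L : List (BondClass × Mat)) (w : Label → E3) : ℝ := (L.map fun e => pairEval e.1 e.2 w).sum

/-- Nonnegativity of the pair form of `L` on all finitely supported label fields. [folklore] -/
def PairFormNonneg (L : List (BondClass × Mat)) : Prop :=
  ∀ w : Label → E3, (support w).Finite → 0 ≤ pairSum L w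

/-- **Stub B1 — BLOCH REDUCTION** (analytic; finite-torus Plancherel for finitely supported two-lattice fields):
a pair-table list whose Bloch symbol is positive semidefinite on the torus has a nonnegative pair form.  (Route-internal stub statement of line
`contragredient-window-collapse`, not a literature fact.) -/
def BlochReduction : Prop := ∀ L : List (BondClass × Mat), SymbolPSD L → PairFormNonneg L

/-! ## The metric window as a convex body and its spectral corners -/

/-- Real quadratic form of a real `3 × 3` matrix. -/
def quadR (G : Matrix (Fin 3) (Fin 3) ℝ) (y : Fin 3 → ℝ) : ℝ := ∑ i, ∑ j, y i * G i j * y j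

/-- `M₀` as a real matrix. -/
def M0R : Matrix (Fin 3) (Fin 3) ℝ := fun i j => (M0Q i j : ℝ)

/-- `M₀⁻¹` as a real matrix. -/
def M0invR : Matrix (Fin 3) (Fin 3) ℝ := fun i j => (M0inv i j : ℝ)

/-- `a² = (189/200)²`. -/
def aSq : ℝ := (189 / 200) ^ 2
/-- `b² = (199/200)²`. -/
def bSq : ℝ := (199 / 200) ^ 2

/-- **The metric window** `Kmetric = {G symmetric : a² M₀ ⪯ G ⪯ b² M₀}` (a convex body in `Sym₃ ≅ ℝ⁶`). [folklore] -/
def Kmetric : Set (Matrix (Fin 3) (Fin 3) ℝ) :=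
  {G | G.IsSymm ∧ ∀ y : Fin 3 → ℝ, aSq * quadR M0R y ≤ quadR G y ∧ quadR G y ≤ bSq * quadR M0R y}

/-- **The spectral corners of the window**: the two points `a² M₀`, `b² M₀` and the two 2-parameter families
`(m + ε) M₀ − 2ε p pᵀ`, `(m − ε) M₀ + 2ε p pᵀ` over the ellipsoid `pᵀ M₀⁻¹ p = 1`
(`m ± ε = b², a²`; `2ε = b² − a²`). [folklore] -/
def cornerSet : Set (Matrix (Fin 3) (Fin 3) ℝ) :=
  {aSq • M0R, bSq • M0R} ∪
    {G | ∃ p : Fin 3 → ℝ, quadR M0invR p = 1 ∧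
      (G = bSq • M0R - (bSq - aSq) • Matrix.vecMulVec p p ∨ G = aSq • M0R + (bSq - aSq) • Matrix.vecMulVec p p)}

/-- **Stub B5 — SPECTRAL CORNER PRINCIPLE** (analytic; simultaneous diagonalisation of `(G, M₀)`, then concavity
on the cube `[a², b²]³` of generalised eigenvalues): a function concave on `Kmetric` and nonnegative on `cornerSet` is
nonnegative on `Kmetric`.  (Route-internal stub statement, not a literature fact.) -/
def SpectralCornerPrinciple : Prop :=
  ∀ f : Matrix (Fin 3) (Fin 3) ℝ → ℝ, ConcaveOn ℝ Kmetric f → (∀ G ∈ cornerSet, 0 ≤ f G) → ∀ G ∈ Kmetric, 0 ≤ f G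

/-! ## Elementary facts -/

/-- The empty list has the zero symbol. [folklore] -/
theorem symbolForm_nil (z : Fin 3 → ℂ) (a : Fin 2 → Fin 3 → ℂ) : symbolForm [] z a = 0 := by
  simp [symbolForm]

/-- The empty list has the zero pair form. [folklore] -/
theorem pairSum_nil (w : Label → E3) : pairSum [] w = 0 := by
  simp [pairSum]

/-- `quadR M0R y = ‖Σ yᵢ genᵢ‖²`. [folklore] -/
theorem quadR_M0R (y : Fin 3 → ℝ) : quadR M0R y = ‖∑ i, y i • gen i‖ ^ 2 := by
  rw [norm_sq_combo]; rfl

/-- **The pulled-back metric of a window cell lies in `Kmetric`.** [folklore] -/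
theorem ghat_mem_Kwin {A : E3 →L[ℝ] E3} (hA : CellWindow A) : (Matrix.of fun i j => ghat A i j) ∈ Kmetric := by
  refine ⟨?_, fun y => ?_⟩
  · ext i j
    simp [Matrix.transpose_apply, ghat_symm A j i]
  · obtain ⟨h1, h2⟩ := chart_cellWindow A hA y
    have hq : quadR (Matrix.of fun i j => ghat A i j) y = ∑ i, ∑ j, y i * ghat A i j * y j := by
      simp [quadR]
    rw [hq, quadR_M0R]
    constructor
    · calc aSq * ‖∑ i, y i • gen i‖ ^ 2 = 893025 / 1000000 * ‖∑ i, y i • gen i‖ ^ 2 := by norm_num [aSq]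
        _ ≤ _ := h1
    · calc ∑ i, ∑ j, y i * ghat A i j * y j ≤ 990025 / 1000000 * ‖∑ i, y i • gen i‖ ^ 2 := h2
        _ = bSq * ‖∑ i, y i • gen i‖ ^ 2 := by norm_num [bSq]

/-- Registered anchor of this vocabulary file (`stub_certBlochDefs`). [folklore] -/
theorem stub_certBlochDefs : ∀ (z : Fin 3 → ℂ) (a : Fin 2 → Fin 3 → ℂ), symbolForm [] z a = 0 :=
  symbolForm_nil

end Summit.AtomisticToContinuum.Crystallization.Theorems.PhononStabilityCWC.Cert

end
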